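import Mathlib
import HarnessLib

/-!
# Crux `FluctuationComparisonRegPrIntL` (stmt-QuantumFields-20520, rung R3), PATH-B organ — «A.E. DIFFERENTIABILITY OF LIPSCHITZ LAW PATHS»: the Carathéodory measurability of
# the differentiability set of a jointly measurable, fibrewise continuous family `w : ℝ → Z → ℝ`, and the a.e.-`s` ∕ a.e.-`z` differentiability of an a.e.-Lipschitz family
# (1-D Rademacher + Fubini) — the fact that makes the (I-law) blocks' pointwise-in-`s` clause (Diff₀) SUPERFLUOUS (TN-CUT-KINK-2, amendment A4; DEFINITION-FREE)

Cell `ym3-torus` (YM ladder rung R3 = continuum `SU(2)` Yang–Mills on the three-torus — a RUNG: NOT d = 4, NOT infinite volume, NOT a mass gap, NOT Clay).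
Width seat `ym-ust-20520-w3` (gen 27, LEAD-20520 organ-tangent lane); `--kind proof --supports stmt-QuantumFields-20520 --as helper`, count-neutral, no registry ∕ binder ∕
`Lines/` edit, default heartbeats, `autoImplicit false`.  Pure measure theory ∕ real analysis over Mathlib; no organ object appears.

WHY (TN-CUT-KINK-2, LEAD №1 (3) A4 ∕ №3 (C); ★★OWNER RULING №83 (3)).  The (I-law) blocks of the organ rows («b» ✓p818968, row-sq ✓p820527; split edition (L36)) carry, besides the
a.e.-`z` LIPSCHITZ clause (Lip) of the fibre weight `s ↦ wNum … t (X s) z` along a coarse law path, a POINTWISE-in-`s` clause (Diff₀) «`∀ s ∈ [0,1], ∀ᵐ z, DifferentiableAt ℝ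
(s ↦ wNum … (X s) z) s`» and a measurability clause for the score.  (Diff₀) is NOT print-shaped: the frozen cut `mwCut` is a product of RAMPS (kinks at `dist1 = 24∕25·θ_n` and
`θ_n∕2`) and `dist1` itself has a cone point at `P = 1`, so (Diff₀) at a given `s` asks that the fibre law `τ` put no mass on the kink locus of `z ↦ Φ(X s, z)` — a transversality
fact about the chart's fibres (real-analytic, non-constant ⟹ null level sets) that is neither in [Balaban1985Variational] ∕ [Balaban1987RG1] nor in Mathlib.  It is also
UNNECESSARY: a.e.-`z` Lipschitz ⟹ (Rademacher, per `z`) a.e.-`s` differentiable ⟹ (Fubini on the MEASURABLE exceptional set) for a.e. `s`, a.e.-`z` differentiable — which is all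
the law-response engines need once they are run through the fundamental theorem of calculus for absolutely continuous functions (✓`…OrganTangentLawResponseLipAE`, next file)
instead of the pointwise mean-value theorem.  The one non-trivial point is the MEASURABILITY of the exceptional set in `ℝ × Z` with NO topology on `Z` (Mathlib's
`measurableSet_of_differentiableAt_with_param` needs a jointly continuous family on a topological parameter space): for a fibrewise CONTINUOUS family the rational Cauchy
criterion for difference quotients writes the differentiability set with countably many measurable conditions (§1–§2).

WHAT.  §1 ★`ratCauchy_of_differentiableAt` ∕ ★`differentiableAt_of_ratCauchy` ∕ `differentiableAt_iff_ratCauchy` (a real function continuous on an open `U ∋ s` is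
differentiable at `s` iff `∀ k ∃ n ∀ h h′ ∈ ℚ∖{0}, |h|,|h′| < 1∕(n+1) → |Δ_h f(s) − Δ_{h′} f(s)| ≤ 1∕(k+1)` — density of `ℚ` + continuity of the slope function + completeness of
`ℝ` via `Cauchy (map slope (𝓝[≠] 0))`), `continuousAt_slope_of_continuousOn`; §2 ★★`measurableSet_differentiableAt_of_continuous_family` (`w` jointly measurable, `s ↦ w s z`
continuous on an open `U` for every `z` ⟹ `{(s,z) | s ∈ U ∧ DifferentiableAt ℝ (w · z) s}` measurable); §3 ★★★`ae_ae_differentiableAt_of_lipschitzOn` (`τ` s-finite, `w` jointly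
measurable, `∀ᵐ z, LipschitzOnWith (K z) (w · z) U` ⟹ `∀ᵐ s, s ∈ U → ∀ᵐ z ∂τ, DifferentiableAt ℝ (w · z) s`; redefinition on a null set of `z`, §2, Mathlib
`LipschitzOnWith.ae_differentiableWithinAt_of_mem_real`, `Measure.measure_prod_null` + `Measure.prod_swap` + `Measure.ae_ae_of_ae_prod`) and its `HasDerivAt ∕ deriv` corollary
★★★`ae_ae_hasDerivAt_deriv_of_lipschitzOn` on `[0,1] ⊆ U` (the shape the AE engines consume).

HONEST FRAMING: textbook real analysis [folklore], no organ object, nothing of Bałaban's analysis asserted or proved; the rows `OrganDischargeInputsHJ(sq)` ∕ `SpreadFibreLawH(J)(sq)`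
are UNDISCHARGED hypothesis rows; LIN″, JEN″, JVARᵘ-H″, O1ᵘ-H v2.2, S1aᴴ, S3ᴴ, S2α′, S2β, 26243, the five registered stubs of `Lines/semiclassical_s2beta.lean` (3732b7df, untouched),
crux 20520 `FluctuationComparisonRegPrIntL` and `YM3TorusSU2` are NOT proved; rung R3 = SU(2) YM₃ on T³ at fixed lattice data — NOT d = 4, NOT infinite volume, NOT a mass gap, NOT
Clay; the Yang–Mills mass gap is NOT proved.  [folklore]
-/

set_option autoImplicit false

noncomputable section

namespace Summit.QuantumFields.YangMills.Theorems.OrganTangentAEDifferentiableFamily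

open MeasureTheory Filter Topology Set Function
open scoped NNReal

variable {Z : Type*} [MeasurableSpace Z]

/-! ## §1 The rational Cauchy criterion for differentiability of a continuous real function -/

/-- (→) A function differentiable at `s` has difference quotients satisfying the rational Cauchy criterion. [folklore] -/
theorem ratCauchy_of_differentiableAt {f : ℝ → ℝ} {s : ℝ} (hf : DifferentiableAt ℝ f s) (k : ℕ) :
    ∃ n : ℕ, ∀ h h' : ℚ, (h ≠ 0 ∧ |(h : ℝ)| < 1 / ((n : ℝ) + 1) ∧ h' ≠ 0 ∧ |(h' : ℝ)| < 1 / ((n : ℝ) + 1)) →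
      |(f (s + h) - f s) / h - (f (s + h') - f s) / h'| ≤ 1 / ((k : ℝ) + 1) := by
  have hd := hf.hasDerivAt
  rw [hasDerivAt_iff_tendsto_slope_zero] at hd
  have hε : (0 : ℝ) < 1 / ((k : ℝ) + 1) / 2 := by positivity
  have hd' := Metric.tendsto_nhdsWithin_nhds.1 hd _ hε
  obtain ⟨δ, hδ, hδ'⟩ := hd'
  obtain ⟨n, hn⟩ := exists_nat_one_div_lt hδ
  refine ⟨n, fun h h' ⟨hh, hhn, hh', hh'n⟩ => ?_⟩
  have e1 : dist ((h : ℝ)⁻¹ • (f (s + h) - f s)) (deriv f s) < 1 / ((k : ℝ) + 1) / 2 := by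
    refine hδ' (by rw [mem_compl_iff, mem_singleton_iff]; exact_mod_cast hh) ?_
    rw [dist_zero_right, Real.norm_eq_abs]; exact hhn.trans hn
  have e2 : dist ((h' : ℝ)⁻¹ • (f (s + h') - f s)) (deriv f s) < 1 / ((k : ℝ) + 1) / 2 := by
    refine hδ' (by rw [mem_compl_iff, mem_singleton_iff]; exact_mod_cast hh') ?_
    rw [dist_zero_right, Real.norm_eq_abs]; exact hh'n.trans hn
  rw [Real.dist_eq, smul_eq_mul] at e1 e2
  rw [div_eq_inv_mul, div_eq_inv_mul]
  have := abs_sub_lt_iff.1 e1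
  have := abs_sub_lt_iff.1 e2
  rw [abs_le]; constructor <;> linarith

/-- Continuity of the difference quotient `t ↦ (f (s + t) − f s)∕t` at a point `a ≠ 0` with `s + a` in the open set of continuity. [folklore] -/
theorem continuousAt_slope_of_continuousOn {f : ℝ → ℝ} {U : Set ℝ} (hU : IsOpen U) (hf : ContinuousOn f U) {s a : ℝ}
    (ha : a ≠ 0) (hsa : s + a ∈ U) : ContinuousAt (fun t : ℝ => (f (s + t) - f s) / t) a := by
  have h1 : ContinuousAt (fun t : ℝ => f (s + t)) a :=
    ((hf.continuousAt (hU.mem_nhds hsa)).comp_of_eq ((continuous_const.add continuous_id).continuousAt) rfl)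
  exact (h1.sub continuousAt_const).div continuousAt_id ha

/-- (←) A continuous (near `s`) real function whose difference quotients satisfy the rational Cauchy criterion is differentiable at `s`. [folklore] -/
theorem differentiableAt_of_ratCauchy {f : ℝ → ℝ} {U : Set ℝ} (hU : IsOpen U) (hf : ContinuousOn f U) {s : ℝ} (hs : s ∈ U)
    (hC : ∀ k : ℕ, ∃ n : ℕ, ∀ h h' : ℚ, (h ≠ 0 ∧ |(h : ℝ)| < 1 / ((n : ℝ) + 1) ∧ h' ≠ 0 ∧ |(h' : ℝ)| < 1 / ((n : ℝ) + 1)) →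
      |(f (s + h) - f s) / h - (f (s + h') - f s) / h'| ≤ 1 / ((k : ℝ) + 1)) :
    DifferentiableAt ℝ f s := by
  -- the slope function
  set g : ℝ → ℝ := fun t => (f (s + t) - f s) / t with hg
  -- a ball around `s` inside `U`
  obtain ⟨δ₀, hδ₀, hball⟩ := Metric.isOpen_iff.1 hU s hs
  -- real Cauchy estimate on a punctured ball, from the rational one by continuity + density
  have key : ∀ k : ℕ, ∃ δ > 0, ∀ a b : ℝ, a ≠ 0 → |a| < δ → b ≠ 0 → |b| < δ → |g a - g b| ≤ 1 / ((k : ℝ) + 1) := by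
    intro k
    obtain ⟨n, hn⟩ := hC k
    refine ⟨min (1 / ((n : ℝ) + 1)) δ₀, lt_min (by positivity) hδ₀, fun a b ha haδ hb hbδ => ?_⟩
    have haU : s + a ∈ U := hball (by rw [Metric.mem_ball, dist_eq_norm, add_sub_cancel_left, Real.norm_eq_abs]; exact haδ.trans_le (min_le_right _ _))
    have hbU : s + b ∈ U := hball (by rw [Metric.mem_ball, dist_eq_norm, add_sub_cancel_left, Real.norm_eq_abs]; exact hbδ.trans_le (min_le_right _ _))
    -- the punctured ball as an open set
    set S : Set ℝ := {t : ℝ | t ≠ 0 ∧ |t| < min (1 / ((n : ℝ) + 1)) δ₀} with hS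
    have hSo : IsOpen S := by
      have : S = (Metric.ball (0 : ℝ) (min (1 / ((n : ℝ) + 1)) δ₀)) \ {0} := by
        ext t; simp only [hS, mem_setOf_eq, Set.mem_sdiff, Metric.mem_ball, dist_zero_right, Real.norm_eq_abs, mem_singleton_iff]; tauto
      rw [this]; exact Metric.isOpen_ball.sdiff isClosed_singleton
    have haS : a ∈ S := ⟨ha, haδ⟩
    have hbS : b ∈ S := ⟨hb, hbδ⟩
    have hgc : ∀ t ∈ S, ContinuousAt g t := fun t ht =>
      continuousAt_slope_of_continuousOn hU hf ht.1
        (hball (by rw [Metric.mem_ball, dist_eq_norm, add_sub_cancel_left, Real.norm_eq_abs]; exact ht.2.trans_le (min_le_right _ _)))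
    have hdense : Dense (range ((↑) : ℚ → ℝ)) := Rat.denseRange_cast
    -- step 1: rational `b'`, real `a`
    have step1 : ∀ b' : ℚ, (b' : ℝ) ∈ S → |g a - g b'| ≤ 1 / ((k : ℝ) + 1) := by
      intro b' hb'
      have hcl : a ∈ closure (S ∩ range ((↑) : ℚ → ℝ)) := hdense.open_subset_closure_inter hSo haS
      have hF : ContinuousWithinAt (fun x : ℝ => |g x - g b'|) (S ∩ range ((↑) : ℚ → ℝ)) a :=
        (((hgc a haS).sub continuousAt_const).abs).continuousWithinAt
      have hG : ContinuousWithinAt (fun _ : ℝ => 1 / ((k : ℝ) + 1)) (S ∩ range ((↑) : ℚ → ℝ)) a := continuousWithinAt_const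
      refine hF.closure_le hcl hG ?_
      rintro y ⟨hyS, ⟨q, rfl⟩⟩
      have h1 : (q : ℚ) ≠ 0 := by exact_mod_cast hyS.1
      have h2 : (b' : ℚ) ≠ 0 := by exact_mod_cast hb'.1
      exact hn q b' ⟨h1, hyS.2.trans_le (min_le_left _ _), h2, hb'.2.trans_le (min_le_left _ _)⟩
    -- step 2: real `b`
    have hcl : b ∈ closure (S ∩ range ((↑) : ℚ → ℝ)) := hdense.open_subset_closure_inter hSo hbS
    have hF : ContinuousWithinAt (fun x : ℝ => |g a - g x|) (S ∩ range ((↑) : ℚ → ℝ)) b :=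
      ((continuousAt_const.sub (hgc b hbS)).abs).continuousWithinAt
    have hG : ContinuousWithinAt (fun _ : ℝ => 1 / ((k : ℝ) + 1)) (S ∩ range ((↑) : ℚ → ℝ)) b := continuousWithinAt_const
    refine hF.closure_le hcl hG ?_
    rintro y ⟨hyS, ⟨q, rfl⟩⟩
    exact step1 q hyS
  -- Cauchy filter ⟹ limit exists
  have hCauchy : Cauchy (map g (𝓝[≠] (0 : ℝ))) := by
    rw [Metric.cauchy_iff]
    refine ⟨map_neBot, fun ε hε => ?_⟩
    obtain ⟨k, hk⟩ := exists_nat_one_div_lt hε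
    obtain ⟨δ, hδ, hδ'⟩ := key k
    refine ⟨g '' {t : ℝ | t ≠ 0 ∧ |t| < δ}, ?_, ?_⟩
    · refine mem_map.2 (mem_of_superset ?_ (subset_preimage_image g _))
      have : {t : ℝ | t ≠ 0 ∧ |t| < δ} = {t : ℝ | t ≠ 0} ∩ Metric.ball 0 δ := by
        ext t; simp [Metric.mem_ball, Real.norm_eq_abs, and_comm]
      rw [this]
      exact inter_mem_nhdsWithin _ (Metric.ball_mem_nhds (0 : ℝ) hδ)
    · rintro x ⟨a, ⟨ha, haδ⟩, rfl⟩ y ⟨b, ⟨hb, hbδ⟩, rfl⟩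
      rw [Real.dist_eq]
      exact (hδ' a b ha haδ hb hbδ).trans_lt hk
  obtain ⟨f', hf'⟩ := CompleteSpace.complete hCauchy
  have : HasDerivAt f f' s := by
    rw [hasDerivAt_iff_tendsto_slope_zero]
    refine (tendsto_congr' ?_).1 hf'
    filter_upwards [self_mem_nhdsWithin] with t (ht : t ≠ 0)
    rw [hg]; simp only [smul_eq_mul]; field_simp
  exact this.differentiableAt


/-- The criterion as an `iff` at a point of an open set of continuity. [folklore] -/
theorem differentiableAt_iff_ratCauchy {f : ℝ → ℝ} {U : Set ℝ} (hU : IsOpen U) (hf : ContinuousOn f U) {s : ℝ} (hs : s ∈ U) :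
    DifferentiableAt ℝ f s ↔ ∀ k : ℕ, ∃ n : ℕ, ∀ h h' : ℚ, (h ≠ 0 ∧ |(h : ℝ)| < 1 / ((n : ℝ) + 1) ∧ h' ≠ 0 ∧ |(h' : ℝ)| < 1 / ((n : ℝ) + 1)) →
      |(f (s + h) - f s) / h - (f (s + h') - f s) / h'| ≤ 1 / ((k : ℝ) + 1) :=
  ⟨fun h k => ratCauchy_of_differentiableAt h k, fun h => differentiableAt_of_ratCauchy hU hf hs h⟩

/-! ## §2 ★★ Carathéodory measurability of the differentiability set of a jointly measurable, fibrewise continuous family -/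

/-- ★★ **CARATHÉODORY MEASURABILITY OF THE DIFFERENTIABILITY SET.**  For `w : ℝ → Z → ℝ` jointly measurable with `s ↦ w s z` continuous on an open `U` for
EVERY `z`, the set `{(s, z) | s ∈ U ∧ DifferentiableAt ℝ (w · z) s}` is measurable in `ℝ × Z` (product σ-algebra; NO topology on `Z` — Mathlib's
`measurableSet_of_differentiableAt_with_param` needs a jointly continuous family).  Proof: the rational Cauchy criterion of §1 writes it with countably many measurable
conditions. [folklore] -/
theorem measurableSet_differentiableAt_of_continuous_family {w : ℝ → Z → ℝ} {U : Set ℝ} (hU : IsOpen U)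
    (hw : Measurable (fun p : ℝ × Z => w p.1 p.2)) (hc : ∀ z, ContinuousOn (fun s => w s z) U) :
    MeasurableSet {p : ℝ × Z | p.1 ∈ U ∧ DifferentiableAt ℝ (fun s => w s p.2) p.1} := by
  -- the countable description
  set D : Set (ℝ × Z) := ⋂ k : ℕ, ⋃ n : ℕ, ⋂ h : ℚ, ⋂ h' : ℚ,
    {p : ℝ × Z | (h ≠ 0 ∧ |(h : ℝ)| < 1 / ((n : ℝ) + 1) ∧ h' ≠ 0 ∧ |(h' : ℝ)| < 1 / ((n : ℝ) + 1)) →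
      |(w (p.1 + h) p.2 - w p.1 p.2) / h - (w (p.1 + h') p.2 - w p.1 p.2) / h'| ≤ 1 / ((k : ℝ) + 1)} with hD
  have hshift : ∀ h : ℚ, Measurable (fun p : ℝ × Z => w (p.1 + h) p.2) := fun h =>
    hw.comp ((measurable_fst.add_const (h : ℝ)).prodMk measurable_snd)
  have hDm : MeasurableSet D := by
    refine MeasurableSet.iInter fun k => MeasurableSet.iUnion fun n => MeasurableSet.iInter fun h => MeasurableSet.iInter fun h' => ?_
    by_cases hcond : (h ≠ 0 ∧ |(h : ℝ)| < 1 / ((n : ℝ) + 1) ∧ h' ≠ 0 ∧ |(h' : ℝ)| < 1 / ((n : ℝ) + 1))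
    · have : {p : ℝ × Z | (h ≠ 0 ∧ |(h : ℝ)| < 1 / ((n : ℝ) + 1) ∧ h' ≠ 0 ∧ |(h' : ℝ)| < 1 / ((n : ℝ) + 1)) →
          |(w (p.1 + h) p.2 - w p.1 p.2) / h - (w (p.1 + h') p.2 - w p.1 p.2) / h'| ≤ 1 / ((k : ℝ) + 1)}
          = {p : ℝ × Z | |(w (p.1 + h) p.2 - w p.1 p.2) / h - (w (p.1 + h') p.2 - w p.1 p.2) / h'| ≤ 1 / ((k : ℝ) + 1)} := by
        ext p; simp only [mem_setOf_eq]; exact ⟨fun H => H hcond, fun H _ => H⟩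
      rw [this]
      refine measurableSet_le ?_ measurable_const
      exact ((((hshift h).sub hw).div_const _).sub (((hshift h').sub hw).div_const _)).abs
    · have : {p : ℝ × Z | (h ≠ 0 ∧ |(h : ℝ)| < 1 / ((n : ℝ) + 1) ∧ h' ≠ 0 ∧ |(h' : ℝ)| < 1 / ((n : ℝ) + 1)) →
          |(w (p.1 + h) p.2 - w p.1 p.2) / h - (w (p.1 + h') p.2 - w p.1 p.2) / h'| ≤ 1 / ((k : ℝ) + 1)} = univ := by
        ext p; simp only [mem_setOf_eq, mem_univ, iff_true]; exact fun H => absurd H hcond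
      rw [this]; exact MeasurableSet.univ
  -- identification on `U ×ˢ univ`
  have hUm : MeasurableSet {p : ℝ × Z | p.1 ∈ U} := measurable_fst hU.measurableSet
  have key : {p : ℝ × Z | p.1 ∈ U ∧ DifferentiableAt ℝ (fun s => w s p.2) p.1} = {p : ℝ × Z | p.1 ∈ U} ∩ D := by
    ext ⟨s, z⟩
    simp only [mem_setOf_eq, mem_inter_iff]
    refine and_congr_right fun hs => ?_
    rw [differentiableAt_iff_ratCauchy hU (hc z) hs, hD]
    simp only [mem_iInter, mem_iUnion, mem_setOf_eq]
  rw [key]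
  exact hUm.inter hDm

/-! ## §3 ★★★ a.e.-`s` ∕ a.e.-`z` differentiability of an a.e.-Lipschitz family (Rademacher 1-D + Fubini) -/

/-- ★★★ **A.E.∕A.E. DIFFERENTIABILITY OF LIPSCHITZ FAMILIES.**  `w : ℝ → Z → ℝ` jointly measurable, `τ` s-finite, and for `τ`-a.e. `z` the path `s ↦ w s z` Lipschitz on an
open `U`.  THEN for Lebesgue-a.e. `s`, `s ∈ U →` for `τ`-a.e. `z`, `s ↦ w s z` is differentiable at `s`.  (Per `z`: 1-D Rademacher
`LipschitzOnWith.ae_differentiableWithinAt_of_mem_real`; the exceptional set is product-measurable by §2 after redefining `w` on a null set of `z`; Tonelli∕`Measure.prod_swap` swaps the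
order of «almost every».)  This is the fact that makes the pointwise-in-`s` differentiability clause (Diff₀) of the organ's (I-law) blocks SUPERFLUOUS. [folklore] -/
theorem ae_ae_differentiableAt_of_lipschitzOn {w : ℝ → Z → ℝ} {U : Set ℝ} (hU : IsOpen U) (τ : Measure Z) [SFinite τ]
    (hw : Measurable (fun p : ℝ × Z => w p.1 p.2)) {K : Z → ℝ≥0} (hlip : ∀ᵐ z ∂τ, LipschitzOnWith (K z) (fun s => w s z) U) :
    ∀ᵐ s ∂(volume : Measure ℝ), s ∈ U → ∀ᵐ z ∂τ, DifferentiableAt ℝ (fun s => w s z) s := by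
  classical
  -- a measurable null set off which every path is Lipschitz
  obtain ⟨N, hNsub, hNm, hN0⟩ := exists_measurable_superset_of_null (ae_iff.1 hlip)
  have hgood : ∀ z, z ∉ N → LipschitzOnWith (K z) (fun s => w s z) U := fun z hz => by
    by_contra H; exact hz (hNsub H)
  -- the modified family: zero on `N`
  set w' : ℝ → Z → ℝ := fun s z => if z ∈ N then 0 else w s z with hw'
  have hw'm : Measurable (fun p : ℝ × Z => w' p.1 p.2) := by
    have hNp : MeasurableSet {p : ℝ × Z | p.2 ∈ N} := measurable_snd hNm
    exact Measurable.ite hNp measurable_const hw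
  have hw'c : ∀ z, ContinuousOn (fun s => w' s z) U := by
    intro z; by_cases hz : z ∈ N
    · simp only [hw', hz, if_true]; exact continuousOn_const
    · simp only [hw', hz, if_false]; exact (hgood z hz).continuousOn
  -- the exceptional set and its measurability
  set E : Set (ℝ × Z) := {p : ℝ × Z | p.1 ∈ U ∧ ¬ DifferentiableAt ℝ (fun s => w' s p.2) p.1} with hE
  have hEm : MeasurableSet E := by
    have h1 : MeasurableSet {p : ℝ × Z | p.1 ∈ U} := measurable_fst hU.measurableSet
    have h2 := measurableSet_differentiableAt_of_continuous_family hU hw'm hw'c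
    have : E = {p : ℝ × Z | p.1 ∈ U} \ {p : ℝ × Z | p.1 ∈ U ∧ DifferentiableAt ℝ (fun s => w' s p.2) p.1} := by
      ext p; simp only [hE, mem_setOf_eq, Set.mem_sdiff, not_and]; tauto
    rw [this]; exact h1.diff h2
  -- every `z`-section is Lebesgue-null (Rademacher 1-D)
  have hsec : ∀ z, (volume : Measure ℝ) {s | (s, z) ∈ E} = 0 := by
    intro z
    have hL : ∃ K', LipschitzOnWith K' (fun s => w' s z) U := by
      by_cases hz : z ∈ N
      · refine ⟨0, ?_⟩; simp only [hw', hz, if_true]; exact (LipschitzWith.const (0 : ℝ)).lipschitzOnWith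
      · refine ⟨K z, ?_⟩; simp only [hw', hz, if_false]; exact hgood z hz
    obtain ⟨K', hK'⟩ := hL
    have hae := hK'.ae_differentiableWithinAt_of_mem_real
    rw [ae_iff] at hae
    refine measure_mono_null ?_ hae
    intro s hs
    simp only [hE, mem_setOf_eq] at hs
    simp only [mem_setOf_eq, Classical.not_imp]
    exact ⟨hs.1, fun H => hs.2 (H.differentiableAt (hU.mem_nhds hs.1))⟩
  -- hence the product measure of `E` vanishes (sections in `z`, then swap)
  have hswap : (τ.prod (volume : Measure ℝ)) {q : Z × ℝ | (q.2, q.1) ∈ E} = 0 := by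
    have hm : MeasurableSet {q : Z × ℝ | (q.2, q.1) ∈ E} := measurable_swap hEm
    rw [Measure.measure_prod_null hm]
    exact Filter.Eventually.of_forall fun z => by simpa using hsec z
  have hprod : ((volume : Measure ℝ).prod τ) E = 0 := by
    rw [← Measure.prod_swap, Measure.map_apply measurable_swap hEm]
    exact hswap
  -- unpack as a.e./a.e.
  have hae : ∀ᵐ p ∂((volume : Measure ℝ).prod τ), p ∉ E := measure_eq_zero_iff_ae_notMem.1 hprod
  have hae2 := Measure.ae_ae_of_ae_prod hae
  have hNae : ∀ᵐ z ∂τ, z ∉ N := measure_eq_zero_iff_ae_notMem.1 hN0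
  filter_upwards [hae2] with s hs hsU
  filter_upwards [hs, hNae] with z hz hzN
  have hz' : DifferentiableAt ℝ (fun s => w' s z) s := by
    by_contra H; exact hz ⟨hsU, H⟩
  have e : (fun s => w' s z) = fun s => w s z := by funext s'; simp only [hw', hzN, if_false]
  rwa [e] at hz'

/-- ★★★ Corollary in `HasDerivAt ∕ deriv` form on `[0,1] ⊆ U` (the shape the AE engines consume). [folklore] -/
theorem ae_ae_hasDerivAt_deriv_of_lipschitzOn {w : ℝ → Z → ℝ} {U : Set ℝ} (hU : IsOpen U) (hUI : Icc (0:ℝ) 1 ⊆ U) (τ : Measure Z) [SFinite τ]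
    (hw : Measurable (fun p : ℝ × Z => w p.1 p.2)) {K : Z → ℝ≥0} (hlip : ∀ᵐ z ∂τ, LipschitzOnWith (K z) (fun s => w s z) U) :
    ∀ᵐ s ∂(volume : Measure ℝ), s ∈ Icc (0:ℝ) 1 → ∀ᵐ z ∂τ, HasDerivAt (fun s => w s z) (deriv (fun s => w s z) s) s := by
  filter_upwards [ae_ae_differentiableAt_of_lipschitzOn hU τ hw hlip] with s hs hsI
  filter_upwards [hs (hUI hsI)] with z hz
  exact hz.hasDerivAt

end Summit.QuantumFields.YangMills.Theorems.OrganTangentAEDifferentiableFamily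

end
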